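import Mathlib.NumberTheory.LSeries.PrimesInAP
import Mathlib.Data.Nat.ChineseRemainder
import Mathlib.FieldTheory.Finite.Basic
import HarnessLib

/-!
# Route `ResidualThetaTransportAtTwo`, cruxes Kan⁺ (stmt-BirchSwinnertonDyer-20688) / node 27436 / 21437: **SAFE DIRICHLET PRIMES** —
# the arithmetic input for the 4-invariance of the `B₁`-character at every ODD level

Cell `bsd-wall`, width seat `bsd-wall-rtt-p3-w5` g2 (2026-08-28), lane «two-fold `B₁`-products at every odd level»; the lead's
(rtt-p3 g9) successor item (2). THEOREMS ONLY (no `def`, no `sorry`); pure arithmetic (Dirichlet + CRT + Fermat/Euler), no matrices;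
`--supports stmt-BirchSwinnertonDyer-20688`. BSD is not proved by this. Consumed by `…CuspSpanFourInvarianceOdd`.

WHY. The lead's 4-invariance at PRIME level (`…CuspSpanFourInvariance` Thm 2) needs, for a unit `u mod p`, an integer `g ≡ u` with
`g ∣ 4^k − 1` and `4^k ≡ 4 (mod p)`; one Dirichlet prime `g = q ≡ −1 (mod 4(p−1))` does it. At a composite or prime-power odd level
`N` the two requirements are compatible iff `gcd(ord_g 4, ord_N 4) = 1`, which a single prime cannot always meet (a prime `r` dividing
both `N` and `ord_N 4` with `u ≡ 1 (mod r)` forces `r ∣ q − 1`). Repair: a PRODUCT of two or three primes in «safe» classes.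

* §1 `exists_prime_modEq_and_coprime_half` (SAFE DIRICHLET PRIME): for odd `N`, `Φ ≠ 0` and `c` coprime to `N` with `c ≢ 1 (mod r)`
  for every prime `r ∣ N`: arbitrarily large primes `q ≡ c (mod N)`, `q ≡ 3 (mod 4)`, `gcd((q−1)/2, Φ) = 1` (CRT over the primes of
  `2NΦ`: `q ≡ 3 (mod 4)`, `q ≡ c (mod r^{v_r(N)})`, `q ≡ 2 (mod r)` for the other primes `r ∣ Φ`).
* §2 `exists_safe_pair` (SAFE FACTORISATION): for odd `N > 1`, every `u` coprime to `N` with `u ≡ 1 (mod 3)` if `3 ∣ N` is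
  `≡ c₁ c₂` with `c₁, c₂` safe (per prime `r ∣ N`: `c₁ ≡ 3` if `u ≡ 2`, else `c₁ ≡ 2`, so `c₁ ≢ 0, 1, u`; CRT; `c₂ := u c₁⁻¹`).
* §3 `exists_prod_primes_dvd_four_pow_sub_one`, `exists_modEq_dvd_four_pow_sub_one` (THE INPUT): for odd `N` and `u` coprime to `N`
  there are `g ≡ u (mod N)` and `k ≥ 1` with `g ∣ 4^k − 1` and `4^k = 4` in `ZMod N` (`g = ∏ qᵢ` over two or three safe primes —
  three, with the extra safe class `2`, exactly when `3 ∣ N` and `u ≡ 2 (mod 3)`; `qᵢ ∣ 4^{(qᵢ−1)/2} − 1` by Fermat;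
  `k ≡ 0 (mod ∏ (qᵢ−1)/2)`, `k ≡ 1 (mod φ(N))`, Euler).

References: P. G. L. Dirichlet (1837) / Mathlib `PrimesInAP`; H. Rademacher, Abh. Math. Sem. Hamburg 7 (1929) §1 [Rademacher1929];
R. Pollack, Duke Math. J. 118 (2003) Conj. 6.3 [Pollack2003].
-/

set_option autoImplicit false
set_option linter.dupNamespace false

namespace Summit.BirchSwinnertonDyer.BirchSwinnertonDyer.Theorems.SignedMuAtTwo

section Arithmetic

variable {N : ℕ}

/-! ## §1. Safe Dirichlet primes -/

/-- **Safe Dirichlet prime.** For odd `N`, `Φ ≠ 0` and `c` coprime to `N` with `c ≢ 1 (mod r)` for every prime `r ∣ N`, and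
any bound `B`: a prime `q > B` with `q ≡ c (mod N)`, `q ≡ 3 (mod 4)` and `gcd((q − 1)/2, Φ) = 1`. [folklore] -/
theorem exists_prime_modEq_and_coprime_half (hN : Odd N) {Φ : ℕ} (hΦ : Φ ≠ 0) {c : ℕ} (hc : c.Coprime N)
    (hsafe : ∀ r : ℕ, r.Prime → r ∣ N → c % r ≠ 1) (B : ℕ) :
    ∃ q : ℕ, B < q ∧ q.Prime ∧ q ≡ c [MOD N] ∧ q % 4 = 3 ∧ ((q - 1) / 2).Coprime Φ := by
  classical
  have hN0 : N ≠ 0 := hN.pos.ne'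
  -- index set, exponents, moduli and residues for the CRT
  set S : Finset ℕ := insert 2 (N.primeFactors ∪ Φ.primeFactors) with hS
  set e : ℕ → ℕ := fun r ↦ if r = 2 then 2 else if r ∣ N then N.factorization r else 1 with he
  set f : ℕ → ℕ := fun r ↦ r ^ e r with hf
  set a : ℕ → ℕ := fun r ↦ if r = 2 then 3 else if r ∣ N then c else 2 with ha
  have hSprime : ∀ r ∈ S, r.Prime := by
    intro r hr
    rcases Finset.mem_insert.mp hr with rfl | hr
    · exact Nat.prime_two
    · rcases Finset.mem_union.mp hr with h | h
      · exact Nat.prime_of_mem_primeFactors h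
      · exact Nat.prime_of_mem_primeFactors h
  have he0 : ∀ r ∈ S, e r ≠ 0 := by
    intro r hr
    simp only [he]
    split_ifs with h2 hrN
    · norm_num
    · exact (Nat.Prime.factorization_pos_of_dvd (hSprime r hr) hN0 hrN).ne'
    · norm_num
  have hs : ∀ r ∈ S, f r ≠ 0 := fun r hr ↦ pow_ne_zero _ (hSprime r hr).ne_zero
  have hpp : Set.Pairwise (↑S : Set ℕ) (Function.onFun Nat.Coprime f) := fun r hr r' hr' hne ↦
    Nat.coprime_pow_primes _ _ (hSprime r hr) (hSprime r' hr') hne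
  obtain ⟨x, hx⟩ := Nat.chineseRemainderOfFinset a f S hs hpp
  have h2S : (2 : ℕ) ∈ S := Finset.mem_insert_self _ _
  have hNS : ∀ r ∈ N.primeFactors, r ∈ S := fun r hr ↦ Finset.mem_insert_of_mem (Finset.mem_union_left _ hr)
  have hΦS : ∀ r ∈ Φ.primeFactors, r ∈ S := fun r hr ↦ Finset.mem_insert_of_mem (Finset.mem_union_right _ hr)
  have hxr : ∀ r ∈ S, x ≡ a r [MOD r] := fun r hr ↦ (hx r hr).of_dvd (dvd_pow_self r (he0 r hr))
  -- the residue `a r` is prime to `r`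
  have har : ∀ r ∈ S, ¬ r ∣ a r := by
    intro r hr hdvd
    simp only [ha] at hdvd
    split_ifs at hdvd with h2 hrN
    · subst h2; revert hdvd; decide
    · have h1 : r ∣ Nat.gcd c N := Nat.dvd_gcd hdvd hrN
      rw [hc.gcd_eq_one] at h1
      exact (hSprime r hr).not_dvd_one h1
    · exact h2 ((Nat.prime_dvd_prime_iff_eq (hSprime r hr) Nat.prime_two).mp hdvd)
  have hxcop : x.Coprime (∏ r ∈ S, f r) := by
    apply Nat.Coprime.prod_right
    intro r hr
    apply Nat.Coprime.pow_right
    rw [Nat.coprime_comm, Nat.Prime.coprime_iff_not_dvd (hSprime r hr)]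
    intro hdvd
    exact har r hr ((Nat.modEq_zero_iff_dvd.mp ((hxr r hr).symm.trans (Nat.modEq_zero_iff_dvd.mpr hdvd))))
  -- DIRICHLET
  obtain ⟨q, hqB, hq, hqx⟩ := Nat.forall_exists_prime_gt_and_modEq (max B c) (q := ∏ r ∈ S, f r)
    (Finset.prod_ne_zero_iff.mpr hs) hxcop
  have hqr : ∀ r ∈ S, q ≡ a r [MOD f r] := fun r hr ↦
    (hqx.of_dvd (Finset.dvd_prod_of_mem f hr)).trans (hx r hr)
  have hqr1 : ∀ r ∈ S, q ≡ a r [MOD r] := fun r hr ↦ (hqr r hr).of_dvd (dvd_pow_self r (he0 r hr))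
  have hcq : c ≤ q := (le_max_right B c).trans hqB.le
  have hq4 : q % 4 = 3 := by
    have h := hqr 2 h2S
    simp only [hf, he, ha, if_pos rfl] at h
    exact h
  refine ⟨q, lt_of_le_of_lt (le_max_left _ _) hqB, hq, ?_, hq4, ?_⟩
  · -- `q ≡ c (mod N)`, prime power by prime power
    refine ((Nat.modEq_iff_dvd' hcq).mpr ?_).symm
    refine (Nat.dvd_iff_prime_pow_dvd_dvd (q - c) N).mpr fun r k hr hrk ↦ ?_
    rcases Nat.eq_zero_or_pos k with rfl | hk
    · simp
    · have hrN : r ∣ N := (dvd_pow_self r hk.ne').trans hrk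
      have hrS : r ∈ S := hNS r (Nat.mem_primeFactors.mpr ⟨hr, hrN, hN0⟩)
      have hr2 : r ≠ 2 := by
        rintro rfl
        exact (Nat.not_even_iff_odd.mpr hN) (even_iff_two_dvd.mpr hrN)
      have hmod : q ≡ c [MOD r ^ N.factorization r] := by
        have h := hqr r hrS
        simp only [hf, he, ha, if_neg hr2, if_pos hrN] at h
        exact h
      have hle : k ≤ N.factorization r := (hr.pow_dvd_iff_le_factorization hN0).mp hrk
      exact (pow_dvd_pow r hle).trans ((Nat.modEq_iff_dvd' hcq).mp hmod.symm)
  · -- `gcd((q − 1)/2, Φ) = 1`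
    apply Nat.coprime_of_dvd
    intro k hk hkq hkΦ
    have hkS : k ∈ S := hΦS k (Nat.mem_primeFactors.mpr ⟨hk, hkΦ, hΦ⟩)
    by_cases hk2 : k = 2
    · subst hk2
      have hodd : (q - 1) / 2 % 2 = 1 := by omega
      have := Nat.mod_eq_zero_of_dvd hkq
      omega
    · have hq1 : k ∣ q - 1 := hkq.trans (Nat.div_dvd_of_dvd (by
        have : q % 2 = 1 := by omega
        exact (Nat.modEq_iff_dvd' (by omega)).mp this.symm))
      have hk3 : 3 ≤ k := by have := hk.two_le; omega
      have hq1k : q % k = 1 := by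
        have h1 : 1 ≡ q [MOD k] := (Nat.modEq_iff_dvd' hq.one_lt.le).mpr hq1
        have h2 : 1 % k = 1 := Nat.mod_eq_of_lt (by omega)
        rw [← h2]; exact h1.symm
      have hqk := hqr1 k hkS
      simp only [ha, if_neg hk2] at hqk
      split_ifs at hqk with hkN
      · exact hsafe k hk hkN (by rw [← hq1k]; exact hqk.symm)
      · have h2k : 2 % k = 2 := Nat.mod_eq_of_lt (by omega)
        unfold Nat.ModEq at hqk
        rw [hq1k, h2k] at hqk
        exact absurd hqk (by norm_num)

/-! ## §2. Safe factorisation of a unit -/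

/-- **Safe factorisation.** For odd `N > 1` and `u` coprime to `N` with `u ≡ 1 (mod 3)` in case `3 ∣ N`: `u ≡ c₁ c₂ (mod N)` with
`c₁, c₂` coprime to `N` and `cᵢ ≢ 1 (mod r)` for every prime `r ∣ N` (per prime: `c₁ ≡ 3` if `u ≡ 2`, else `c₁ ≡ 2`; CRT).
[folklore] -/
theorem exists_safe_pair (hN : Odd N) (hN1 : N ≠ 1) {u : ℕ} (hu : u.Coprime N) (h3 : 3 ∣ N → u % 3 = 1) :
    ∃ c₁ c₂ : ℕ, c₁.Coprime N ∧ c₂.Coprime N ∧ c₁ * c₂ ≡ u [MOD N] ∧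
      (∀ r : ℕ, r.Prime → r ∣ N → c₁ % r ≠ 1) ∧ (∀ r : ℕ, r.Prime → r ∣ N → c₂ % r ≠ 1) := by
  classical
  have hN0 : N ≠ 0 := hN.pos.ne'
  have hN2 : 1 < N := by omega
  set S : Finset ℕ := N.primeFactors with hS
  set f : ℕ → ℕ := fun r ↦ r ^ N.factorization r with hf
  set a : ℕ → ℕ := fun r ↦ if u % r = 2 then 3 else 2 with ha
  have hSprime : ∀ r ∈ S, r.Prime := fun r hr ↦ Nat.prime_of_mem_primeFactors hr
  have hs : ∀ r ∈ S, f r ≠ 0 := fun r hr ↦ pow_ne_zero _ (hSprime r hr).ne_zero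
  have hpp : Set.Pairwise (↑S : Set ℕ) (Function.onFun Nat.Coprime f) := fun r hr r' hr' hne ↦
    Nat.coprime_pow_primes _ _ (hSprime r hr) (hSprime r' hr') hne
  obtain ⟨x, hx⟩ := Nat.chineseRemainderOfFinset a f S hs hpp
  have hxr : ∀ r : ℕ, r.Prime → r ∣ N → x % r = a r % r := fun r hr hrN ↦
    (hx r (Nat.mem_primeFactors.mpr ⟨hr, hrN, hN0⟩)).of_dvd
      (dvd_pow_self r (Nat.Prime.factorization_pos_of_dvd hr hN0 hrN).ne')
  -- the three residue facts: `a r ≢ 0, 1, u (mod r)` for every prime `r ∣ N`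
  have key : ∀ r : ℕ, r.Prime → r ∣ N → a r % r ≠ 0 ∧ a r % r ≠ 1 ∧ a r % r ≠ u % r := by
    intro r hr hrN
    have hr2 : r ≠ 2 := by
      rintro rfl
      exact (Nat.not_even_iff_odd.mpr hN) (even_iff_two_dvd.mpr hrN)
    have hr3 : 3 ≤ r := by have := hr.two_le; omega
    by_cases hur : u % r = 2
    · simp only [ha, if_pos hur]
      by_cases hr3' : r = 3
      · subst hr3'
        have := h3 hrN
        omega
      · have h3r : 3 % r = 3 := Nat.mod_eq_of_lt (by omega)
        rw [h3r, hur]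
        omega
    · simp only [ha, if_neg hur]
      have h2r : 2 % r = 2 := Nat.mod_eq_of_lt (by omega)
      rw [h2r]
      exact ⟨by omega, by omega, Ne.symm hur⟩
  -- `c₁ := x`
  have hxcop : x.Coprime N := by
    apply Nat.coprime_of_dvd
    intro k hk hkx hkN
    have h0 : x % k = 0 := Nat.mod_eq_zero_of_dvd hkx
    exact (key k hk hkN).1 (by rw [← hxr k hk hkN, h0])
  obtain ⟨y, -, hy⟩ := Nat.exists_mul_mod_eq_one_of_coprime hxcop hN2
  have hxy : x * y ≡ 1 [MOD N] := by
    unfold Nat.ModEq; rw [hy, Nat.mod_eq_of_lt hN2]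
  -- `c₂ := u y`
  have hprod : x * (u * y) ≡ u [MOD N] := by
    have e : x * (u * y) = u * (x * y) := by ring
    rw [e]
    simpa using hxy.mul_left u
  have hc₂cop : (u * y).Coprime N := by
    have h1 : (x * (u * y)).Coprime N := by
      unfold Nat.Coprime; rw [hprod.gcd_eq]; exact hu
    exact Nat.Coprime.coprime_mul_left h1
  refine ⟨x, u * y, hxcop, hc₂cop, hprod, fun r hr hrN ↦ ?_, fun r hr hrN h1 ↦ ?_⟩
  · rw [hxr r hr hrN]; exact (key r hr hrN).2.1
  · -- `u y ≡ 1 (mod r)` would give `x ≡ u (mod r)`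
    have e1 : x * (u * y) ≡ x [MOD r] := by
      have : x * (u * y) ≡ x * 1 [MOD r] := (Nat.ModEq.refl x).mul (by
        unfold Nat.ModEq; rw [h1, Nat.mod_eq_of_lt hr.one_lt])
      simpa using this
    have e2 : x * (u * y) ≡ u [MOD r] := hprod.of_dvd hrN
    have e3 : x % r = u % r := e1.symm.trans e2
    exact (key r hr hrN).2.2 (by rw [← hxr r hr hrN, e3])

/-! ## §3. The arithmetic input: `g ≡ u (mod N)`, `g ∣ 4^k − 1`, `4^k ≡ 4 (mod N)` -/

/-- From a list of safe classes: distinct safe Dirichlet primes `qᵢ` in those classes, `g := ∏ qᵢ ≡ ∏ cᵢ (mod N)`,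
`P := ∏ (qᵢ − 1)/2` coprime to `Φ`, and `g ∣ 4^P − 1` (Fermat: `4^{(q−1)/2} = 2^{q−1} ≡ 1 (mod q)`). [folklore] -/
theorem exists_prod_primes_dvd_four_pow_sub_one (hN : Odd N) {Φ : ℕ} (hΦ : Φ ≠ 0) :
    ∀ L : List ℕ, (∀ c ∈ L, c.Coprime N ∧ ∀ r : ℕ, r.Prime → r ∣ N → c % r ≠ 1) →
      ∃ g P : ℕ, 0 < g ∧ 0 < P ∧ g ≡ L.prod [MOD N] ∧ P.Coprime Φ ∧ (g : ℤ) ∣ 4 ^ P - 1 := by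
  intro L
  induction L with
  | nil =>
    intro _
    exact ⟨1, 1, one_pos, one_pos, by simp [Nat.ModEq.refl], Nat.coprime_one_left _, by norm_num⟩
  | cons c L ih =>
    intro hL
    obtain ⟨g, P, hg, hP, hgL, hPΦ, hgdvd⟩ := ih (fun c' hc' ↦ hL c' (List.mem_cons_of_mem _ hc'))
    obtain ⟨hc, hcs⟩ := hL c List.mem_cons_self
    obtain ⟨q, hqg, hq, hqc, hq4, hqh⟩ := exists_prime_modEq_and_coprime_half hN hΦ hc hcs g
    have hq3 : 3 ≤ q := by have := hq.two_le; omega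
    set h : ℕ := (q - 1) / 2 with hh
    have hh0 : 0 < h := by omega
    -- Fermat: `q ∣ 4^h − 1`
    haveI : Fact q.Prime := ⟨hq⟩
    have h2q : (2 : ZMod q) ≠ 0 := by
      intro h0
      have h0' : ((2 : ℕ) : ZMod q) = 0 := by exact_mod_cast h0
      have := (Nat.prime_dvd_prime_iff_eq hq Nat.prime_two).mp ((ZMod.natCast_eq_zero_iff 2 q).mp h0')
      omega
    have h4h : (4 : ZMod q) ^ h = 1 := by
      rw [show (4 : ZMod q) = 2 ^ 2 by norm_num, ← pow_mul, show 2 * h = q - 1 by omega,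
        ZMod.pow_card_sub_one_eq_one h2q]
    have hqdvd : (q : ℤ) ∣ 4 ^ h - 1 := by
      rw [← ZMod.intCast_zmod_eq_zero_iff_dvd]; push_cast; rw [h4h, sub_self]
    refine ⟨q * g, h * P, Nat.mul_pos hq.pos hg, Nat.mul_pos hh0 hP, ?_, Nat.Coprime.mul_left hqh hPΦ, ?_⟩
    · rw [List.prod_cons]; exact hqc.mul hgL
    · have h1 : (q : ℤ) ∣ 4 ^ (h * P) - 1 := by
        refine hqdvd.trans ?_
        rw [pow_mul]
        simpa using sub_dvd_pow_sub_pow ((4 : ℤ) ^ h) 1 P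
      have h2 : (g : ℤ) ∣ 4 ^ (h * P) - 1 := by
        refine hgdvd.trans ?_
        rw [mul_comm, pow_mul]
        simpa using sub_dvd_pow_sub_pow ((4 : ℤ) ^ P) 1 h
      have hcop : IsCoprime (q : ℤ) (g : ℤ) := by
        rw [Nat.isCoprime_iff_coprime, Nat.Prime.coprime_iff_not_dvd hq]
        exact fun hd ↦ absurd (Nat.le_of_dvd hg hd) (not_le.mpr hqg)
      push_cast
      exact hcop.mul_dvd h1 h2

/-- **The arithmetic input for 4-invariance at an odd level.** For odd `N` and `u` coprime to `N`: `g > 0`, `k ≥ 1` with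
`g ≡ u (mod N)`, `g ∣ 4^k − 1` and `4^k = 4` in `ZMod N` (`g` a product of two or three safe Dirichlet primes according as
`u ≡ 1` or `2 (mod 3)` when `3 ∣ N`; `k ≡ 0 (mod ∏ (qᵢ−1)/2)`, `k ≡ 1 (mod φ(N))`). [folklore] -/
theorem exists_modEq_dvd_four_pow_sub_one (hN : Odd N) {u : ℕ} (hu : u.Coprime N) :
    ∃ g k : ℕ, 0 < g ∧ 1 ≤ k ∧ g ≡ u [MOD N] ∧ (g : ℤ) ∣ 4 ^ k - 1 ∧ (4 : ZMod N) ^ k = 4 := by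
  rcases eq_or_ne N 1 with rfl | hN1
  · exact ⟨1, 1, one_pos, le_rfl, Nat.modEq_one, by norm_num, Subsingleton.elim _ _⟩
  have hN0 : N ≠ 0 := hN.pos.ne'
  have hN2 : 1 < N := by omega
  set Φ : ℕ := N.totient with hΦdef
  have hΦ : Φ ≠ 0 := (Nat.totient_pos.mpr hN.pos).ne'
  have h2cop : Nat.Coprime 2 N := Nat.coprime_two_left.mpr hN
  -- the list of safe classes with product `≡ u`
  obtain ⟨L, hL, hLprod⟩ : ∃ L : List ℕ, (∀ c ∈ L, c.Coprime N ∧ ∀ r : ℕ, r.Prime → r ∣ N → c % r ≠ 1) ∧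
      L.prod ≡ u [MOD N] := by
    by_cases h3 : 3 ∣ N → u % 3 = 1
    · obtain ⟨c₁, c₂, hc₁, hc₂, hprod, hs₁, hs₂⟩ := exists_safe_pair hN hN1 hu h3
      refine ⟨[c₁, c₂], ?_, by simpa using hprod⟩
      intro c hc
      simp only [List.mem_cons, List.not_mem_nil, or_false] at hc
      rcases hc with rfl | rfl
      exacts [⟨hc₁, hs₁⟩, ⟨hc₂, hs₂⟩]
    · push Not at h3
      obtain ⟨h3N, hu3⟩ := h3
      have hu3' : u % 3 = 2 := by
        have h0 : u % 3 ≠ 0 := fun h0 ↦ by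
          have h1 : 3 ∣ Nat.gcd u N := Nat.dvd_gcd (Nat.dvd_of_mod_eq_zero h0) h3N
          rw [hu.gcd_eq_one] at h1
          exact absurd (Nat.le_of_dvd one_pos h1) (by norm_num)
        omega
      -- `u' := u · (N+1)/2 ≡ u/2 ≡ 1 (mod 3)`
      have hhalf : 2 * ((N + 1) / 2) = N + 1 := Nat.two_mul_div_two_of_even (hN.add_odd odd_one)
      have hhalfcop : ((N + 1) / 2).Coprime N := by
        apply Nat.coprime_of_dvd
        intro k hk hk1 hk2
        have h1 : k ∣ N + 1 := hk1.trans (Dvd.intro_left 2 hhalf)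
        have h2 : k ∣ 1 := (Nat.dvd_add_right hk2).mp h1
        exact hk.not_dvd_one h2
      have hu'cop : (u * ((N + 1) / 2)).Coprime N := Nat.Coprime.mul_left hu hhalfcop
      have hu'3 : 3 ∣ N → u * ((N + 1) / 2) % 3 = 1 := fun _ ↦ by
        have hN3 : N % 3 = 0 := Nat.mod_eq_zero_of_dvd h3N
        have hN2' : N % 2 = 1 := Nat.odd_iff.mp hN
        have hh3 : (N + 1) / 2 % 3 = 2 := by omega
        rw [Nat.mul_mod, hu3', hh3]
      obtain ⟨c₁, c₂, hc₁, hc₂, hprod, hs₁, hs₂⟩ := exists_safe_pair hN hN1 hu'cop hu'3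
      refine ⟨[2, c₁, c₂], ?_, ?_⟩
      · intro c hc
        simp only [List.mem_cons, List.not_mem_nil, or_false] at hc
        rcases hc with rfl | rfl | rfl
        · refine ⟨h2cop, fun r hr hrN ↦ ?_⟩
          have hr3 : 3 ≤ r := by
            have := hr.two_le
            have hr2 : r ≠ 2 := by
              rintro rfl
              exact (Nat.not_even_iff_odd.mpr hN) (even_iff_two_dvd.mpr hrN)
            omega
          rw [Nat.mod_eq_of_lt (by omega)]; norm_num
        exacts [⟨hc₁, hs₁⟩, ⟨hc₂, hs₂⟩]
      · have e : [2, c₁, c₂].prod = 2 * (c₁ * c₂) := by simp [List.prod_cons]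
        rw [e]
        have h1 : 2 * (c₁ * c₂) ≡ 2 * (u * ((N + 1) / 2)) [MOD N] := hprod.mul_left 2
        refine h1.trans ?_
        have e2 : 2 * (u * ((N + 1) / 2)) = u + u * N := by
          rw [mul_left_comm, hhalf]; ring
        rw [e2]
        unfold Nat.ModEq
        rw [Nat.add_mul_mod_self_right]
  obtain ⟨g, P, hg, hP, hgL, hPΦ, hgdvd⟩ := exists_prod_primes_dvd_four_pow_sub_one hN hΦ L hL
  -- `k ≡ 0 (mod P)`, `k ≡ 1 (mod Φ)`, `k ≥ 1`
  obtain ⟨k₀, hk₀P, hk₀Φ⟩ := Nat.chineseRemainder hPΦ 0 1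
  set k : ℕ := k₀ + P * Φ with hk
  have hk1 : 1 ≤ k := le_trans (Nat.mul_pos hP (Nat.pos_of_ne_zero hΦ)) (Nat.le_add_left _ _)
  have hPk : P ∣ k := (Nat.modEq_zero_iff_dvd.mp hk₀P).add (dvd_mul_right P Φ)
  have hΦk : k ≡ 1 [MOD Φ] := by
    have : k ≡ k₀ [MOD Φ] := by
      unfold Nat.ModEq; rw [hk, Nat.add_mul_mod_self_right]
    exact this.trans hk₀Φ
  refine ⟨g, k, hg, hk1, hgL.trans hLprod, ?_, ?_⟩
  · obtain ⟨t, ht⟩ := hPk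
    rw [ht, pow_mul]
    exact hgdvd.trans (by simpa using sub_dvd_pow_sub_pow ((4 : ℤ) ^ P) 1 t)
  · obtain ⟨t, ht⟩ := (Nat.modEq_iff_dvd' hk1).mp hΦk.symm
    have hkt : k = Φ * t + 1 := by omega
    have h4cop : Nat.Coprime 4 N := by simpa using h2cop.pow_left 2
    have h4Φ : (4 : ZMod N) ^ Φ = 1 := by
      have h := ZMod.pow_totient (ZMod.unitOfCoprime 4 h4cop)
      have h' := congrArg (Units.val : (ZMod N)ˣ → ZMod N) h
      rw [Units.val_pow_eq_pow_val, ZMod.coe_unitOfCoprime, Units.val_one] at h'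
      exact_mod_cast h'
    rw [hkt, pow_succ, pow_mul, h4Φ, one_pow, one_mul]

end Arithmetic

end Summit.BirchSwinnertonDyer.BirchSwinnertonDyer.Theorems.SignedMuAtTwo
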